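import Literature.NumberTheory.EllipticCurves.Sprung2012.SharpFlatKatoDivisibility
import Literature.NumberTheory.EllipticCurves.Kato2004.EulerSystemClasses
import Literature.NumberTheory.EllipticCurves.KatoFineSelmerDual
import HarnessLib

/-!
# Sprung 2012, Def. 6.1 + Props. 7.3/7.6 + exact sequence (3) of Thm. 7.14 (= first half of Prop. 7.19)
# at the TRIVIAL tame character (`ℚ_∞`), with Kato 2004 Thm. 12.6 / Ex. 13.3 (the zeta submodule is
# spanned by GENUINE Euler-system classes) and the image sentence «`Col^{♯/♭}(z_Kato) = L^{♯/♭}_p(E, X)`»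
# read on IDEALS at every height-one prime — ONE hypothesis structure (`SharpFlatColemanKatoData`) on the
# tree's PINNED `𝐇¹_Γ(T_pW)` / `X^•(E/ℚ_∞)` / `X₀(E/ℚ_∞)` + ONE construction fact
# (`thm714seq_sharpFlatColemanKato_zeta`) — the ♯/♭ twin of `Kobayashi2003/SignedColemanKatoZeta.lean`

Topic `NumberTheory/EllipticCurves`, sub-directory `Sprung2012` (namespace = path). Filed by cell
`bsd-print-x8` (HOME `run/shared/lean/pub/bsd-print-x8/`), seat `bsd-print-x8-p1` gen 2 (prover; sentence
«Sprung 2024 (a_p ≠ 0 ♯♭ main-conjecture consequences for BSD_p) BY NAME: acquire, type, discharge»),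
route `PrintX8`, crux item stmt-BirchSwinnertonDyer-20402 `SharpFlatMainConjectureSmallImageX8` (the ♯/♭
main [C] on the 61 X8 pairs with non-surjective `ρ̄_{E,3}`), whose μ-part (planner g2's child
«`μ(X^•) ≤ μ(Λ/(L^•))`», p3 g1's `PrintX8SmallImageMuSplit`) is the object served. HONEST FRAMING:
nothing about any curve is asserted; no census cell moves; BSD is not proved by any of this. THIS FILE:
one hypothesis STRUCTURE whose fields are printed statements RELATIVE TO PINNED OBJECTS of the tree, and
one named CONSTRUCTION fact (`def … : Prop`, D-0014; nothing asserted, no `_holds`; net debt +1) saying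
the structure is inhabited. It is, FIELD FOR FIELD, the ♯/♭ copy of the ACCEPTED `a_p = 0` file
`Kobayashi2003/SignedColemanKatoZeta.lean` (cell `bsd-ssimc`, seat `k3-c4x`, p529649: structure
`SignedColemanKatoData` + fact `thm62_63_73_signedColemanKato_zeta`), with Kobayashi's `Col^±`, `Sel^±`,
`L_p^±` replaced by Sprung's `Col^{♯/♭}` (Def. 5.9/7.1), `Sel^{♯/♭}` (Def. 7.11) and `L^{♯/♭}_p(E, X)`
(Def. 6.1), valid for EVERY supersingular `a_p` (`p ∣ a_p`, `p` odd — in particular `(p, a_p) = (3, ±3)`).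
No instance, no notation, no attribute is declared or removed; no theorem is claimed from print beyond
the conjunction below.

## Why this file (the consumer)

Cell `bsd-ssimc` kernel-checked the Kato `μ`-TRANSFER WITHOUT BIG IMAGE at a good supersingular prime
with `a_p = 0` (`Theorems/SignedLowerHalvesKobayashiMainConjectureSmallImageSignedMuTransfer.lean`,
`SmallImageSignedMuTransfer.signedMu_eq_zero_of_hasUnitContent`: `ρ̄` not onto, one unit coefficient of
`L_p^ε(E)` ⟹ `μ(X^ε(E/ℚ_∞)) = 0`, modulo `thm62_63_73_signedColemanKato_zeta`; reduction-free core
`CoreAssembly.coreOdd_anyReduction_holds`, part 1 `…SmallImageFineMuAnyReduction`). Route `PrintX8`'s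
residual crux 20402 lives at `(3, a₃ = ±3)` with image `N_ns⁺(3)`, where Sprung's Thm. 7.16 gives
`Char X^• ⊇ (pⁿ L^•)` with `n = 0` ONLY under `GL₂(ℤ₃)`-surjectivity; given the Eisenstein half (K1,
item 19875) the crux is EXACTLY the μ-inequality `μ(X^•) ≤ μ(Λ/(ϖL^•))` (p3 g1,
`Theorems/PrintX8SmallImageMuSplit.lean`). The present fact is the ♯/♭ input that lets the K6 chain run at
such a pair: with it, `Summits/…/Theorems/PrintX8SharpFlatMuTransfer.lean` (this seat) proves
«`HasUnitContent(L^•_3(E))` ⟹ `μ(X^•(E/ℚ_∞)) = 0`» CLASS-WIDE at non-surjective image, hence the μ-child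
modulo published facts and that one analytic rider (decidable per pair; class-wide = the Perrin-Riou /
Pollack `μ = 0` expectation).

## Source, verbatim (F. E. I. Sprung, *Iwasawa theory for elliptic curves at supersingular primes: A pair
## of main conjectures*, J. Number Theory 132 (2012) 1483–1506 [Sprung2012]; held copy
## `paper:doi-10-1016-j-jnt-2011-11-003`, chunk `p00NN` = printed page `1482 + NN`, read by this seat
## 2026-08-27, pp. 1495–1505; the ♯/♭ glyphs are LOST in that text layer — `∗ ∈ {♯, ♭}` below)

§5, p. 1495: "**Definition 5.9.** Let the Coleman map `Col : H¹_Iw(T) → Λ ⊕ Λ` be the projective limit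
of `Col_n : H¹(k_n, T) → (Λ_n ⊕ Λ_n)/Ker h_n`, where `Λ = ℤ_p[Δ][[X]]`." §6, p. 1495: "**Definition 6.1.**
For `p` odd, let `z^± = (z_n^±)_n ∈ H¹_Iw(T) = lim← H¹(k_n, T)` be Kato's zeta elements (see [Kobayashi,
Theorem 5.2 i] and [Ka, Theorem 12.5]). Write `(L♯_p(E, η, X), L♭_p(E, η, X))` for the `η`-component of
the image of `η(−1) Col(z_{η(−1)})` in `Λ²`, which we naturally view as an element of `ℤ_p[[X]]² ≅
(Λ^η)²`." p. 1498: "**Main Theorem 6.12.** `log♯_α(1+X) L♯_p(E, η, X) + log♭_α(1+X) L♭_p(E, η, X) =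
L_p(E, α, η, X)`"; "**Proposition 6.14.** … at least one of `L♯_p(E, η, X)` and `L♭_p(E, η, X)` is a
nonzero function." §7 (p. 1499: "From now on, assume `p` is odd."), p. 1500: "**Definition 7.1.**
`Col =: (Col♯, Col♭)`." "**Proposition 7.3.** `Col♭` is surjective." p. 1501: "**Proposition 7.6.** If `η`
is trivial, then `ε_η Col♯` is surjective. If `η` is nontrivial, then `Im(ε_η Col♯) = J^η`." p. 1503:
"**Definition 7.9.** We let `E♯_{∞,𝔭}` (resp. `E♭_{∞,𝔭}`) be the exact annihilator of `Ker Col♯` (resp.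
`Ker Col♭`) under the local Tate pairing." "**Definition 7.11.** We now define our two Selmer groups:
`Sel♯(E/K_∞) := Ker(Sel(E/K_∞) → E(K_{∞,𝔭}) ⊗ ℚ_p/ℤ_p / E♯_{∞,𝔭})`, `Sel♭(E/K_∞) := …`. We also define
their Pontryagin duals `X^∗(E/K_∞) := Hom(Sel^∗(E/K_∞), ℚ_p/ℤ_p)` for `∗ ∈ {♯, ♭}`." "**Definition 7.12.**
… We define `𝐇¹(T) := lim←_n H^1(Spec O_{K_n}[1/p], j_*T)`. We let `Z(T)` be the `Λ`-submodule of `𝐇¹(T)`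
generated by Kato's zeta elements `z⁺` and `z⁻`. (We can make this definition since `p` is
supersingular. See [Kobayashi, Section 5] or [Ka] for more details.)" p. 1504: "**Definition 7.13.**
`X⁰(E/K_∞)` is the Pontryagin dual to Kurihara's Selmer group … `Sel⁰(E/K_∞) := Ker(Sel(E/K_∞) →
E(K_{∞,𝔭}) ⊗ ℚ_p/ℤ_p)`." "**Theorem 7.14.** Let `p` be an odd supersingular prime, `η : Δ → ℤ_p^×` be a
character, and `∗ ∈ {♯, ♭}` be chosen so that `L^∗_p(E, η, X) ≠ 0`. Then `X^∗(E/K_∞)^η` is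
`ℤ_p[[X]]`-torsion. *Proof.* From [Kobayashi, Proposition 7.1 and the limit of (7.18)], we have the exact
sequence `𝐇¹(T)^η → H¹_Iw(T)^η → X(E/K_∞)^η → X⁰(E/K_∞)^η → 0` … Since `L^∗_p(E, η, X) ≠ 0` by
assumption, the arguments in the proof of [Kobayashi, Theorem 7.3 i] provide us with an injection `ι` in
the exact sequence of `ℤ_p[[X]]`-modules
`0 → 𝐇¹(T)^η →^ι H¹_Iw(T)^η / Ker ε_η Col^∗ → X^∗(E/K_∞)^η → X⁰(E/K_∞)^η → 0`. (3)
To see that the entire sequence is exact, we can use the Cassels–Poitou–Tate exact sequence (cf. [PR,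
Appendix A.3.2] or [CS, Theorem 1.5]) and the discussion in [Kobayashi] preceding (7.16)." p. 1505:
"**Proposition 7.19.** Choose `∗ ∈ {♯, ♭}` so that `L^∗_p(E, η, X) ≠ 0`. Then there are exact sequences
… `0 → 𝐇¹(T)^η/Z(T)^η → Λ^η/L^∗_p(E, η, X) → X^∗(E/K_∞)^η → X⁰(E/K_∞)^η → 0` if not [`∗ = ♯, η ≠ 1`].
*Proof.* This follows from the exact sequence (3) in the proof of Theorem 7.14, Proposition 7.3, and
Proposition 7.6." Kato / Kobayashi inputs as quoted in `Kobayashi2003/SignedColemanKatoZeta.lean`: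
S. Kobayashi, Invent. Math. 152 (2003), Thm. 5.1 iii) (`𝐇¹(T)` free of rank one when `T/pT` irreducible),
Thm. 5.2 iv) + Remark 5.3 i) (`Z(T) ⊆ 𝐇¹(T)` at a supersingular prime — NO condition on `a_p`), §8.7
(`Col` is determined by the dual-exponential values); K. Kato, Astérisque 295 (2004), Thm. 12.6 (p. 222)
+ Ex. 13.3 (p. 225) (the finite-index submodule `Z ⊂ Z(f,T)` generated by GENUINE Euler systems).

## Transcription — what the structure says, field by field, and the reading flags (for the referee)

Frame: `p` odd; `W/ℚ` globally minimal with good SUPERSINGULAR reduction at `p`, i.e. `p ∣ a_p` (any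
`a_p`: hypotheses of the fact, not of the structure; the structure facts `ContinuousSMul ℤ_[p] (T_pW)`,
`Module.Free/Finite ℤ_[p] (T_pW)` are instance BINDERS, discharged Summits-side exactly as for the
Kobayashi twin); `f` a newform of `W` (`IsNewformOf W f`, any level); `ϖ ∈ ℚ` the period ratio
`ϖ·Ω_E = Ω⁺_f` (so Sprung's NÉRON-normalised `L^∗_p(E, X)` (Def. 6.1 via Kato's `z` and `Ω_E`, Thm.
6.2/6.4) is `ϖ · L^•` for the tree's `Ω⁺_f`-normalised chromatic member `L^• = Sprung2017.chromaticL • L♯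
L♭` of the Sprung pair of `f` (`Sprung2017.IsSprungPair f p a_p L♯ L♭` — Sprung's pair IS characterised by
the Mazur–Tate congruences and is UNIQUE, tree theorem `Sprung2017.IsSprungPair.unique`; the SAME
spelling «`ι g = C(ϖ) · ι L^•`» as the route leaf `Theorems.SprungSharpFlatMainConjecture` and as the
flag `Sp12-716-period` of `thm716_sharpFlatCharIdeal_divisibility`; `ϖ` is carried EXPLICITLY, so no
period-unit statement is used or needed here); `κ` the cyclotomic `ℤ_p`-extension of `ℚ` with
topological generator `γ` MATCHING THE CYCLOTOMIC VARIABLE (`IsCyclotomicVariable p γ`: "By sending `γ`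
to `(1 + X)` …", p. 1486); the place `v ∣ p` (`ι = closureEmb`), a local lift `g` of `γ`, a Honda system
`(cneg, c)` (`Sprung2012.IsHondaSystem`; Thm. 2.2) — the data through which the tree DEFINES `Ker Col^•`,
`E^•_{∞,𝔭}` and `Sel^•` (`Sprung2012/ColemanMaps.lean`, `SharpFlatSelmer.lean`), exactly the binder list
of `thm714_…` / `thm716_…`; a colour `•`; and the PINNED `I : Kato2004.IwasawaH1Data W p κ γ`
(`I.H = 𝐇¹_Γ(T_pW)` = the `Δ`-trivial component `𝐇¹(T)^{η=1}` of Def. 7.12). Then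
`SharpFlatColemanKatoData W p f ϖ κ γ ι a_p g c • I` records:
* `col : I.H →ₗ[Λ] Λ` — «`ε_1 Col^• ∘ loc_p` on the `Δ`-trivial component»: the arrow `ι` of (3) (colour
  `•`, `η = 1`) composed with the isomorphism `H¹_Iw(T)^{η=1}/Ker ε_1 Col^• ≃ Λ^{η=1} = ℤ_p[[X]]` given by
  Prop. 7.3 (`• = ♭`) resp. Prop. 7.6, first sentence (`• = ♯`, `η = 1`) — the identification Sprung
  himself composes in to pass from (3) to Prop. 7.19 ("This follows from the exact sequence (3) …,
  Proposition 7.3, and Proposition 7.6");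
* `col_injective` — `ι` is injective WHEN `L^•_p(E, X) ≠ 0` (Thm. 7.14's hypothesis "`∗` chosen so that
  `L^∗_p(E, η, X) ≠ 0`"; printed proof "the arguments in the proof of [Kobayashi, Theorem 7.3 i]":
  `𝐇¹(T)` free of rank one, Thm. 5.1 iii), so injective iff non-zero, and `Col^∗(z) = L^∗ ≠ 0`). Unlike
  the `a_p = 0` twin (where `L_p^± ≠ 0` always, Rohrlich) ONE of `L♯_p, L♭_p` may vanish identically
  (Prop. 6.14 / [C] 6.15), so the field is CONDITIONAL on `chromaticL • L♯ L♭ ≠ 0` for a (= the) Sprung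
  pair — never stronger than print;
* `Z : Submodule Λ I.H` with `zeta_le_span` — «Kato's Thm. 12.6 submodule `Z`, projected to the
  `Δ`-trivial component»: `Z ≤ span{s | IsEulerSystemClass W p κ γ I s}`, VERBATIM the span clause of the
  twin and of `Kato2004.exists_divisibilityInputs_fineQuotient_zeta` (Thm. 12.6 + Ex. 13.3: each generator
  is the `p`-power line of a GENUINE integral Euler system). No hypothesis on `a_p` is involved (Def.
  7.12: "We can make this definition since `p` is supersingular"; Kobayashi Thm. 5.2 iv) / Remark 5.3 i):
  `Z(T) ⊆ 𝐇¹(T)` whenever `T/pT` is irreducible, automatic at a supersingular prime);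
* `image_zeta_localized` — Def. 6.1 («`(L♯_p, L♭_p)(E, X)` IS the `η = 1` component of `Col(z)`») with
  Def. 7.12 and Kato Thm. 12.6 (finite index), read on IDEALS at every height-one prime `𝔭` of `Λ`,
  under `Irr(E[p])`: for every Sprung pair `(L♯, L♭)` of `f` (tree normalisation `Ω⁺_f`) and `G₁ ∈ Λ`
  with `ι G₁ = C(ϖ)·ι(chromaticL • L♯ L♭)` (= Sprung's NÉRON-normalised `L^•_p(E, X) ∈ ℤ_p[[X]]`), SOME
  `s ∉ 𝔭` has `s·G₁ ∈ col(Z)` and `s·col(z) ∈ (G₁)` for all `z ∈ Z` — i.e. the ideals `col(Z)` and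
  `(L^•_p)` agree after localisation at `𝔭`. WHY THIS SHAPE: exactly as in the twin — Kato's `Z` (Thm.
  12.6) has FINITE INDEX in `Z(f,T) = Z(T) = Λz⁺ + Λz⁻` (Def. 7.12), so `Z_𝔭 = Z(T)_𝔭` at every
  height-one `𝔭`; on the `Δ`-trivial component `ε_1 Col^•(Z(T)) = Λ·L^•_p(E, X)`: `ε_1 Col^•(z⁺) = L^•_p(E,
  X)` by Def. 6.1 with `η = 1` (`η(−1) = 1`, `z_{η(−1)} = z⁺`), while `ε_1 Col(z⁻) = 0` since the
  dual-exponential values of `z⁻_n` vanish at every character `ψ` of `G_n` with `ψ(−1) = 1` (Kato/Kobayashi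
  Thm. 5.2 i): "`δ = 0`" off the sign) and `Col_n` is given by those values (Prop. 6.3 = [Kobayashi, Prop.
  8.25]: `P_{n,x}(z) = (Σ log x^σ σ)(Σ exp*(z^σ) σ⁻¹)`). The identification of Def. 6.1's pair with the
  tree's Sprung pair (up to the unit `ϖ·Ω_E/Ω⁺_f`-bookkeeping made explicit by `G₁`) is Main Thm. 6.12 +
  Sprung 2017 (ANT 11) Cor. 4.4–4.5 / Thm. 1.12 (the pair is determined by the Mazur–Tate congruences),
  the SAME identification under which `thm716_sharpFlatCharIdeal_divisibility` was typed (its flag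
  `Sp12-716-period`). Units of `ℤ_p` (Néron/canonical period unit, sign conventions `η(−1)`, `Ỹ`) are
  absorbed by the ideal-level statement with slack `s`. Flag for the referee:
  `Sp12-61-eta1-ideal-localized` (reading, not a gap);
* `exact` — the exact sequence (3) of the proof of Thm. 7.14 at `η = 1`, colour `•`, with the
  isomorphism of Props. 7.3/7.6 composed in (= Prop. 7.19's second display BEFORE quotienting by `Z(T)`):
  for EVERY Pontryagin-dual datum `D` of `Sel^•(E/ℚ_∞)` (`SharpFlatSelmerDualData W κ γ ι a_p g c •`, Def.
  7.11 — exists by the tree theorem `Sprung2012.nonempty_sharpFlatSelmerDualData`) and EVERY dual datum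
  `Y` of the fine Selmer group `Sel₀(ℚ_∞, E[p^∞])` (`WeierstrassCurve.FineSelmerDualData W κ γ` = Def.
  7.13's `X⁰(E/K_∞)` on the `Δ`-trivial component: Kurihara's `Sel⁰` = everywhere-locally-trivial classes
  since `E(K_{n,v}) ⊗ ℚ_p/ℤ_p = 0` for `v ∤ p`, the SAME reading as the twin and as
  `Kato2004.exists_divisibilityInputs_fineQuotient`), SOME `Λ`-linear `j : Λ → D.X`, `k : D.X → Y.X` with
  `I.H →^{col} Λ →ʲ D.X →ᵏ Y.X → 0` exact. Exactness at `Λ` and at `X^•` is printed UNCONDITIONALLY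
  ("To see that the entire sequence is exact, we can use the Cassels–Poitou–Tate exact sequence"); only
  the injectivity of `ι` needs `L^• ≠ 0` (field `col_injective`). The maps are existential: the printed
  deductions (Thm. 7.14, Prop. 7.19, Thm. 7.16) use exactness only. Flag `Sp12-714seq-eta1-maps-existential`.
READING FLAGS. `Sp12-eta1-Ftower` (inherited from `thm714_…` / `thm716_…`, module docstring of
`SharpFlatKatoDivisibility.lean`): Defs. 7.9–7.13, Thm. 7.14, Prop. 7.19 are PRINTED for `K_∞ = ℚ(ζ_{p^∞})`
with `Δ`-components; the `Δ`-trivial component is the `ℚ_∞`-object of §1 (Thm. 1.2 / 1.4: "The statements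
here correspond to the `η = 1` case in the more precise statements of Section 7", p. 1486) — the
identification under which the tree's `SharpFlatSelmerDualData` (ℤ_p-tower form), `FineSelmerDualData`
and `IwasawaH1Data` are the pinned ends. NOT formalised in the tree; the fields are stated directly on
the `ℚ_∞`-objects. Everything recorded is implied by, never stronger than, the print.

## What is NOT here (and why)

* NO Coleman map on LOCAL objects as a value statement (Def. 3.1 pairings, Prop. 5.3, Def. 5.9 — the
  tree's `Sprung2012/ColemanMaps.lean` carries `Ker Col^•` as a predicate), no `exp*`, no Thm. 6.2/6.4
  interpolation, no Main Thm. 6.12 as a separate field, no Props. 7.3/7.6 as separate fields (used only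
  inside `exact`, to write the local term of (3) as `Λ`; their `_holds` live in
  `Sprung2012/ColemanMapSurjectiveProofs.lean` for the tree's LOCAL Coleman maps), no Thm. 7.14 (the named
  fact `thm714_sharpFlatSelmerDual_finite_torsion`), no Thm. 7.16 / 7.18 (the named fact
  `thm716_sharpFlatCharIdeal_divisibility`), no Prop. 7.17 (Kurihara; the fine dual is torsion: sibling
  `KatoFineSelmerDualTorsion`); no components `η ≠ 1` (the ideal `J`, the `1/X` clause); no `_holds`
  (Kato's Euler system and explicit reciprocity law, Sprung's Coleman maps on Iwasawa cohomology,
  Poitou–Tate along the tower: none of it is in Mathlib; size XL).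
* NO main [C] (Main [C] 7.21 / 1.3, [C] 6.15, [C] 7.15) is asserted; the Summits-side typed missing input
  for `(E, 3, •)` stays what it is. (Docstring convention of the sibling files: the source's C-word is
  written `[C]` in declaration docstrings; this module docstring carries the unaltered quotations.)

References: [Sprung2012] Def. 3.1 (p. 1489), Prop. 5.3, Def. 5.9 (pp. 1493–1495), Def. 6.1, Thm. 6.2,
Prop. 6.3, Thm. 6.4 (pp. 1495–1496), Main Thm. 6.12, Rem. 6.13, Prop. 6.14 (p. 1498), Def. 7.1–7.2,
Prop. 7.3 (p. 1500), Prop. 7.6 (p. 1501), Def. 7.9, Lemma 7.10, Def. 7.11, Def. 7.12 (p. 1503), Def. 7.13,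
Thm. 7.14 with (3), Thm. 7.16, Prop. 7.17, Thm. 7.18 (p. 1504), Prop. 7.19, Main [C] 7.21 (p. 1505), §1
Thm. 1.2 / 1.4 (p. 1486); [Kobayashi2003] Thm. 5.1 iii), Thm. 5.2 i)/iv), Remark 5.3 i) (pp. 9–10), Prop.
7.1, (7.16)–(7.20) (p. 12), Thm. 7.3 i) (p. 13), Prop. 8.25 / §8.7 (pp. 25–26); [Kato2004Asterisque] §12.2
(p. 220), Thm. 12.4–12.6 (pp. 221–222), Ex. 13.3 (p. 225), §13.8 (p. 228); [Sprung2017] ANT 11 (2017) Thm.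
1.12, Cor. 4.4–4.5 (the pair characterised); [GreenbergVatsal2000] §3 (period unit, used by Kobayashi in
Thm. 5.2 iv)); tree: `Sprung2012/{ColemanMaps, SharpFlatSelmer, SharpFlatSelmerDualExistsProofs,
SharpFlatKatoDivisibility, ColemanMapSurjectiveProofs}.lean`, `Kobayashi2003/SignedColemanKatoZeta.lean`
(the twin), `Kato2004/{IwasawaCohomology, EulerSystemClasses, DivisibilityInputsFine}.lean`,
`KatoFineSelmerDual.lean`.
-/

noncomputable section

open scoped MatrixGroups ModularForm NumberField

open CongruenceSubgroup WeierstrassCurve Field NumberField IsDedekindDomain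
  Literature.NumberTheory.EllipticCurves Literature.NumberTheory.EllipticCurves.ModularForms
  Literature.NumberTheory.GaloisRepresentations Literature.NumberTheory.EllipticCurves.Kato2004
  Literature.NumberTheory.EllipticCurves.Kato2004.EulerSystemValues ZpExtension
  Literature.NumberTheory.EllipticCurves.Sprung2017

namespace Literature.NumberTheory.EllipticCurves.Sprung2012

/-! ## §1 The hypothesis structure: Def. 6.1 + Props. 7.3/7.6 + (3) of Thm. 7.14 at `η = 1`, with Kato's
Thm. 12.6 zeta submodule, relative to the pinned `𝐇¹_Γ(T_pW)`, `X^•(E/ℚ_∞)`, `X₀(E/ℚ_∞)` -/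

/-- **Sprung's Coleman / Poitou–Tate data for the colour `•` at the trivial character, with Kato's zeta
submodule, on pinned objects** (hypothesis structure; nothing asserted by it — existence is the named
fact `thm714seq_sharpFlatColemanKato_zeta`). Parameters: a globally minimal elliptic `W/ℚ`, an odd good
supersingular prime `p` (any `a_p` with `p ∣ a_p`; hypotheses of the fact, not of the structure), a
newform `f` of `W`, the period ratio `ϖ` (`ϖ·Ω_E = Ω⁺_f`), the cyclotomic `(κ, γ)`, the local data
`(ι, a_p, g, c)` through which the tree defines `Ker Col^•` and `Sel^•` (`Sprung2012/ColemanMaps.lean`,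
`SharpFlatSelmer.lean`), a colour `•` and Kato's pinned `I : Kato2004.IwasawaH1Data W p κ γ`
(`I.H = 𝐇¹_Γ(T_pW) = 𝐇¹(T)^{η=1}`). Fields: a `Λ`-linear `col : 𝐇¹ → Λ` («`ε_1 Col^• ∘ loc_p` through
Props. 7.3/7.6 on the `Δ`-trivial component»), injective WHEN `L^•_p(E, X) ≠ 0` (Thm. 7.14's proof, the
arrow `ι` of (3)); Kato's zeta submodule `Z ≤ 𝐇¹` bounded above by the span of GENUINE `Λ`-adic
Euler-system classes (Kato Thm. 12.6 + Ex. 13.3, verbatim the span clause of the twin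
`Kobayashi2003.SignedColemanKatoData`); under `Irr(E[p])`, Def. 6.1 read on ideals — `col(Z)` and
`(L^•_p(E, X))` (Néron normalisation: `ι G₁ = C(ϖ)·ι(chromaticL • L♯ L♭)`, `(L♯, L♭)` the tree's Sprung
pair of `f`) agree after localisation at every height-one prime; and (3) with the Coleman isomorphism
composed in — for EVERY dual datum `D` of `Sel^•(E/ℚ_∞)` and EVERY dual datum `Y` of `Sel₀(ℚ_∞, E[p^∞])`
some `Λ`-linear `Λ → X^• → X₀` make `𝐇¹ →^{col} Λ → X^• → X₀ → 0` exact (arrows existential). Module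
docstring: field-by-field locators and the reading flags `Sp12-eta1-Ftower`,
`Sp12-61-eta1-ideal-localized`, `Sp12-714seq-eta1-maps-existential`.
[cite: Sprung2012, Def. 6.1 (p. 1495), Def. 7.1 and Prop. 7.3 (p. 1500), Prop. 7.6 (p. 1501), Def. 7.9, 7.11, 7.12 (p. 1503), Def. 7.13 and Thm. 7.14 with exact sequence (3) (p. 1504), Prop. 7.19 (p. 1505), Prop. 6.14 (p. 1498)]
[cite: Kato2004Asterisque, Thm. 12.6 (p. 222), Ex. 13.3 (p. 225), §12.2 (p. 220) and §13.8 (p. 228)]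
[cite: Kobayashi2003, Thm. 5.1 iii), Thm. 5.2 iv) and Remark 5.3 i) (pp. 9–10), Thm. 7.3 i) (p. 13)] -/
structure SharpFlatColemanKatoData (W : WeierstrassCurve ℚ) [W.IsElliptic] (p : ℕ) [Fact p.Prime]
    [ContinuousSMul ℤ_[p] (W.tateModule p)] [Module.Free ℤ_[p] (W.tateModule p)]
    [Module.Finite ℤ_[p] (W.tateModule p)] {N : ℕ} (f : CuspForm (Gamma0 N) 2) (ϖ : ℚ)
    (κ : ZpExtension ℚ p) (γ : absoluteGaloisGroup ℚ)
    {E : Type} [Field E] [Algebra ℚ E] (ι : AlgebraicClosure ℚ →ₐ[ℚ] AlgebraicClosure E) (ap : ℤ)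
    (g : absoluteGaloisGroup E) (c : ℕ → localPoints W E) (col : Chroma)
    (I : Kato2004.IwasawaH1Data W p κ γ) where
  /-- «`ε_1 Col^• ∘ loc_p`» on the `Δ`-trivial component: the arrow `ι` of (3) (colour `•`, `η = 1`)
  composed with the isomorphism `H¹_Iw(T)^{η=1}/Ker ε_1 Col^• ≃ ℤ_p[[X]]` of Prop. 7.3 (`♭`) / Prop. 7.6
  (`♯`, `η = 1`). -/
  colMap : I.H →ₗ[IwasawaAlgebra p] IwasawaAlgebra p
  /-- Thm. 7.14, proof: `ι : 𝐇¹(T) → H¹_Iw(T)/Ker ε_1 Col^•` is injective when `L^•_p(E, X) ≠ 0` (the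
  colour is "chosen so that `L^∗_p ≠ 0`"; `𝐇¹(T)` free of rank one, so injective iff non-zero). -/
  colMap_injective : ∀ (Lsharp Lflat : IwasawaAlgebra p), IsSprungPair f p ap Lsharp Lflat →
    chromaticL col Lsharp Lflat ≠ 0 → Function.Injective colMap
  /-- Kato Thm. 12.6: the `Λ`-span `Z ⊂ 𝐇¹(T)` of the `p`-power lines of the integral zeta elements
  (8.1.3)/(8.11), projected to the `Δ`-trivial component `𝐇¹_Γ(T_pW)` (inside Def. 7.12's `Z(T)` with
  finite index). -/
  Z : Submodule (IwasawaAlgebra p) I.H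
  /-- Kato Thm. 12.6 with Ex. 13.3: every generator of `Z` is the `Λ`-adic class of a GENUINE integral
  Euler system (`Kato2004.IsEulerSystemClass`), so `Z` lies in the span of such classes — verbatim the
  span clause of the twin `Kobayashi2003.SignedColemanKatoData`. -/
  zeta_le_span : Z ≤ Submodule.span (IwasawaAlgebra p) {s : I.H | Kato2004.IsEulerSystemClass W p κ γ I s}
  /-- Def. 6.1 (`η = 1`: `(L♯_p, L♭_p)(E, X)` = the `η = 1` component of `Col(z⁺)`) with Def. 7.12 and
  Kato Thm. 12.6 (finite index), read on IDEALS at every height-one prime: for every Sprung pair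
  `(L♯, L♭)` of `f` (tree normalisation `Ω⁺_f`) and `G₁ ∈ Λ` with `ι G₁ = C(ϖ)·ι(chromaticL • L♯ L♭)`
  (Sprung's Néron-normalised `L^•_p(E, X)`), the ideals `colMap(Z)` and `(G₁)` of `Λ` agree after
  localisation at `𝔭`: some `s ∉ 𝔭` multiplies each into the other. -/
  image_zeta_localized : W.HasIrreducibleModPGaloisRep p →
    ∀ (Lsharp Lflat G₁ : IwasawaAlgebra p), IsSprungPair f p ap Lsharp Lflat →
      iwasawaToPowerSeries p G₁ =
        PowerSeries.C ((ϖ : ℚ) : ℚ_[p]) * iwasawaToPowerSeries p (chromaticL col Lsharp Lflat) →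
      ∀ 𝔭 : PrimeSpectrum (IwasawaAlgebra p), 𝔭.asIdeal.height = 1 →
        ∃ s : IwasawaAlgebra p, s ∉ 𝔭.asIdeal ∧
          s * G₁ ∈ Submodule.map colMap Z ∧
          ∀ z ∈ Z, s * colMap z ∈ Ideal.span {G₁}
  /-- (3) of Thm. 7.14's proof, colour `•`, `Δ`-trivial component, with Props. 7.3/7.6 composed in: for
  every dual datum `D` of `Sel^•(E/ℚ_∞)` and every dual datum `Y` of `Sel₀(ℚ_∞, E[p^∞])`,
  `𝐇¹ →^{col} Λ → X^• → X₀ → 0` is exact for SOME `Λ`-linear `Λ → X^•`, `X^• → X₀` (exactness at `Λ` and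
  at `X^•` is unconditional in print: Cassels–Poitou–Tate). -/
  exact : ∀ (D : SharpFlatSelmerDualData W κ γ ι ap g c col) (Y : W.FineSelmerDualData κ γ),
    ∃ (j : IwasawaAlgebra p →ₗ[IwasawaAlgebra p] D.X) (k : D.X →ₗ[IwasawaAlgebra p] Y.X),
      Function.Exact colMap j ∧ Function.Exact j k ∧ Function.Surjective k

/-! ## §2 The named fact: the structure is inhabited (Def. 6.1 + Props. 7.3/7.6 + (3) at `η = 1`, with
Kobayashi Thm. 5.1 iii) / 5.2 iv) / Remark 5.3 i) and Kato Thm. 12.6 / Ex. 13.3), for EVERY supersingular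
`a_p` -/

/-- **Sprung 2012, Def. 6.1 + Props. 7.3/7.6 + Thm. 7.14's exact sequence (3) at the trivial character
(`ℚ_∞`, the `Δ`-trivial component), together with Kato 2004 Thm. 12.6 / Ex. 13.3, on pinned objects.**
For every elliptic curve `E/ℚ` with globally minimal model `W` (structure facts of `T_pW` as instance
BINDERS, as in the twin `Kobayashi2003.thm62_63_73_signedColemanKato_zeta`), every ODD prime `p` of good
reduction with `p ∣ a_p` (supersingular — ANY `a_p`, in particular `(3, ±3)`: §§5–7 assume only "`p`
odd supersingular"), every newform `f` of `W` with period ratio `ϖ` (`ϖ·Ω_E = Ω⁺_f`), the cyclotomic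
`ℤ_p`-extension `κ` with topological generator `γ` matching the cyclotomic variable, the place `v ∣ p`
with a local lift `g` of `γ` and a Honda system `(cneg, c)` (Thm. 2.2; the binder list of
`thm714_sharpFlatSelmerDual_finite_torsion`), every colour `•` and every pinned
`I : Kato2004.IwasawaH1Data W p κ γ` (`𝐇¹(T)^{η=1}`):
`SharpFlatColemanKatoData W p f ϖ κ γ (closureEmb _) a_p g c • I` is inhabited — by `ε_1 Col^• ∘ loc_p`
composed with Props. 7.3/7.6 (injective when `L^• ≠ 0`: Thm. 7.14's proof, from Kobayashi Thm. 5.1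
iii) — Remark 5.3 i) — and Def. 6.1), Kato's Thm. 12.6 submodule `Z` (inside the span of genuine
Euler-system classes, Ex. 13.3; inside `𝐇¹(T)` and of finite index in `Z(T)` by Kobayashi Thm. 5.2 iv)
for supersingular `p`, Def. 7.12), the Def. 6.1 identity `ε_1 Col^•(z⁺) = L^•_p(E, X)` (NÉRON
normalisation: `ι G₁ = C(ϖ)·ι(chromaticL • L♯ L♭)` with `(L♯, L♭)` the tree's Sprung pair of `f`) read on
ideals localized at each height-one prime, and the `Δ`-trivial component of (3)
`0 → 𝐇¹(T) → H¹_Iw(T)/Ker ε_1 Col^• ≃ Λ → X^•(E/K_∞) → X⁰(E/K_∞) → 0` for every dual datum of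
`Sel^•(E/ℚ_∞)` (Def. 7.11) and of `Sel₀(ℚ_∞, E[p^∞])` (Def. 7.13). A CONSTRUCTION fact (weaker than
print: the identity of `col`, `j`, `k` is forgotten up to the listed properties; `Z` only bounded above
by the span), never stronger; nothing asserted; no `_holds` expected soon (Honda theory §2, Kato §§8–13,
Poitou–Tate along the tower: none in Mathlib; size XL). READING FLAGS (module docstring):
`Sp12-eta1-Ftower`, `Sp12-61-eta1-ideal-localized`, `Sp12-714seq-eta1-maps-existential`. Consumer (kernel,
Summits-side, seat `bsd-print-x8-p1` g2): «`HasUnitContent(L^•_p(E))` ⟹ `μ(X^•(E/ℚ_∞)) = 0`» at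
NON-surjective image (the ♯/♭ twin of `SmallImageSignedMuTransfer.signedMu_eq_zero_of_hasUnitContent`),
hence the μ-part of route `PrintX8`'s crux 20402 modulo published facts and the analytic rider.

KEYING CAVEAT (recorded 2026-08-28; x8 dossier T67 (m) / T69 (d) / T70 (b), cell referee R-250 / R-275,
director-bsd (266) R1′; TYPED ≠ PRINTED here — do not cite this constant as Sprung's theorem without the
involution). The package's field `exact` quantifies over dual data `D : SharpFlatSelmerDualData W κ γ …`,
`Y : W.FineSelmerDualData κ γ` carrying the SAME key `γ` as Kato's covariant `I : Kato2004.IwasawaH1Data W p κ γ`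
(`1 + T ↦ γ`, `IwasawaH1Data.proj_T_smul`). Under the tree's Pontryagin-dual convention
(`SharpFlatSelmerDualData.toDual_T_smul`, `WeierstrassCurve.FineSelmerDualData.toDual_T_smul`: `T` acts on a dual
by PRE-composition with `conj_γ`, i.e. by the contragredient action of `γ⁻¹`) the printed `X^•(E/ℚ_∞)`,
`X⁰(E/ℚ_∞)` of [Sprung2012] (3) p. 1504 — Pontryagin duals with their NATURAL `Λ`-action, about which (3) and
Prop. 7.19 are `Λ`-linear statements (cf. [Greenberg1989] pp. 101–102 `S^ι`; [Nekovar2006] 8.9.6.1–2,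
(9.1.4.2) and p. 263; [PerrinRiou1995Asterisque] §2.5.1, A.3.2) — are the data of key `γ⁻¹`. So this
statement is the printed one composed with the Iwasawa involution `ι` (`γ ↦ γ⁻¹`) out of `Λ`: it agrees with
print iff the ideal `colMap(𝐇¹) ⊆ Λ` is `ι`-symmetric prime by prime — true up to units at `a_p = 0`
(`Sprung2017.cor414_sharpFlat_functionalEquation_apZero_holds`), unprinted at `(p, a_p) = (3, ±3)`; the μ-,
λ- and `ι`-fixed-prime content (the consumer above uses only μ) is keying-immune. The PRINT-KEYED
transcription (duals of key `γ⁻¹`, covariant side unchanged) is `thm714seq_sharpFlatColemanKato_zeta_contra` in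
`Sprung2012/SharpFlatColemanKatoContragredient.lean`, whose module docstring spells the comparison out; the kernel
dictionary between the two keyings is `Sprung2012/SharpFlatSelmerDualInvolutionTwistProofs.lean`
(`sharpFlatSelmerDualData_mem_charIdeal_inv_iff`, `…_lengthAt_inv_eq`; μ/λ immune). The JOINT sibling
`thm714seq_sharpFlatColemanKato_zetaJoint` (which implies this one, `thm714seq_sharpFlatColemanKato_zeta_of_joint`)
is negated problem-side from print-keyed facts and one X8 cell datum — see its docstring. Kept unchanged for
its consumers; a print-keyed consumer should bind the `_contra` sibling.
[cite: Sprung2012, Def. 6.1 (p. 1495), Prop. 7.3 (p. 1500), Prop. 7.6 (p. 1501), Def. 7.9, 7.11, 7.12 (p. 1503), Def. 7.13, Thm. 7.14 with (3) (p. 1504), Prop. 7.19 (p. 1505), Main Thm. 6.12 and Prop. 6.14 (p. 1498), Thm. 2.2 (p. 1487)]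
[cite: Kato2004Asterisque, Thm. 12.5 and Thm. 12.6 (p. 222), Ex. 13.3 (p. 225), §12.2 (p. 220), §13.8 (p. 228)]
[cite: Kobayashi2003, Thm. 5.1 iii), Thm. 5.2 i)/iv) and Remark 5.3 i) (pp. 9–10), Prop. 7.1 and (7.16)–(7.20) (p. 12), Thm. 7.3 i) (p. 13), Prop. 8.25 (p. 25)]
[cite: Sprung2017, Thm. 1.12 and Cor. 4.4–4.5 (the pair characterised by the Mazur–Tate congruences)] -/
def thm714seq_sharpFlatColemanKato_zeta : Prop :=
  ∀ (W : WeierstrassCurve ℚ) [W.IsElliptic] [W.IsGloballyMinimal] (p : ℕ) [Fact p.Prime]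
    [ContinuousSMul ℤ_[p] (W.tateModule p)] [Module.Free ℤ_[p] (W.tateModule p)]
    [Module.Finite ℤ_[p] (W.tateModule p)] {N : ℕ} [NeZero N] (f : CuspForm (Gamma0 N) 2) (ϖ : ℚ)
    (κ : ZpExtension ℚ p) (γ : absoluteGaloisGroup ℚ),
    p ≠ 2 → W.HasGoodReductionAtPrime p → (p : ℤ) ∣ W.frobeniusTrace p → IsNewformOf W f →
    (ϖ : ℝ) * W.realPeriodRat = plusPeriod f →
    κ.IsCyclotomic → κ.IsTopGenerator γ → IsCyclotomicVariable p γ →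
    ∀ (v : HeightOneSpectrum (𝓞 ℚ)), (p : 𝓞 ℚ) ∈ v.asIdeal →
    ∀ (g : absoluteGaloisGroup (v.adicCompletion ℚ)),
      κ.IsTopGenerator (resGalOfEmb (closureEmb (K := ℚ) (v.adicCompletion ℚ)) g) →
    ∀ (cneg : localPoints W (v.adicCompletion ℚ)) (c : ℕ → localPoints W (v.adicCompletion ℚ)),
      IsHondaSystem κ (closureEmb (K := ℚ) (v.adicCompletion ℚ)) W (W.frobeniusTrace p) g cneg c →
    ∀ (col : Chroma) (I : Kato2004.IwasawaH1Data W p κ γ),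
      Nonempty (SharpFlatColemanKatoData W p f ϖ κ γ (closureEmb (K := ℚ) (v.adicCompletion ℚ))
        (W.frobeniusTrace p) g c col I)

end Literature.NumberTheory.EllipticCurves.Sprung2012

end
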